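import Literature.IUT.LogVolume.RArithmeticDivisors
import HarnessLib

/-!
# [IUTchIV] Def. 1.9 vs Dupuy–Hilado §2.5.4: finite-part Arakelov divisors inside `ADiv_ℝ(F)`

Bridge (theorems only) between the two divisor groups of this directory: Dupuy–Hilado's `ℝ`-divisors
supported on FINITE places, `FinDivisor F = HeightOneSpectrum (𝓞 F) →₀ ℝ` with `deĝ_F`, `deĝ̲_F`
(`ArakelovDivisors.lean`, abc-iut-c312-3; [cite: DupuyHilado2025, §2.5.4]), and Mochizuki's
`ADiv_ℝ(F) = Place F →₀ ℝ` with `deg_F`, `deg` ([IUTchIV] Def. 1.9 (i), `RArithmeticDivisors.lean`): the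
embedding `ofFinDivisor : Div̂(F)_0 ⊗ ℝ → ADiv_ℝ(F)` (extension by zero at the archimedean places) is
`ℝ`-linear, injective, and intertwines the degrees — `degF ∘ ofFinDivisor = deĝ_F`,
`ndeg ∘ ofFinDivisor = deĝ̲_F` — since both assign `log q_v = ln|κ(v)|` to a finite place. So the pilot
divisors of Dupuy–Hilado Thm. 3.10.1 ("supported only at finite places") and Mochizuki's `𝔮`, `𝔣`, `𝔡`
(Thm. 1.10) live in one group with one degree. [cite: Mochizuki2012, IUTchIV Def. 1.9 (i) p. 21]
[cite: DupuyHilado2025, §2.5.4]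
-/

noncomputable section

namespace Literature.IUT.LogVolume

open NumberField IsDedekindDomain

variable (F : Type*) [Field F] [NumberField F]

namespace ADivisor

/-- Extension by zero at the archimedean places: `Div̂(F)_0 ⊗ ℝ ↪ ADiv_ℝ(F)`, `Σ a_v[v] ↦ Σ a_v·v`.
[cite: Mochizuki2012, IUTchIV Def. 1.9 (i) p. 21] -/
def ofFinDivisor : FinDivisor F →ₗ[ℝ] ADivisor F := Finsupp.lmapDomain ℝ ℝ Sum.inr

variable {F}

omit [NumberField F] in
/-- Coefficient of `ofFinDivisor D` at a finite place. [cite: Mochizuki2012, IUTchIV Def. 1.9 (i) p. 21] -/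
@[simp] theorem ofFinDivisor_apply_inr (D : FinDivisor F) (v : HeightOneSpectrum (𝓞 F)) :
    ofFinDivisor F D (Sum.inr v) = D v := by
  simp [ofFinDivisor, Finsupp.lmapDomain_apply, Finsupp.mapDomain_apply Sum.inr_injective]

omit [NumberField F] in
/-- Coefficient of `ofFinDivisor D` at an archimedean place is `0`. [cite: Mochizuki2012, IUTchIV Def. 1.9 (i) p. 21] -/
@[simp] theorem ofFinDivisor_apply_inl (D : FinDivisor F) (v : InfinitePlace F) :
    ofFinDivisor F D (Sum.inl v) = 0 := by
  rw [ofFinDivisor, Finsupp.lmapDomain_apply, Finsupp.mapDomain_notin_range]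
  rintro ⟨w, hw⟩
  exact Sum.inr_ne_inl hw

omit [NumberField F] in
/-- `ofFinDivisor` is injective. [cite: Mochizuki2012, IUTchIV Def. 1.9 (i) p. 21] -/
theorem ofFinDivisor_injective : Function.Injective (ofFinDivisor F) := by
  intro D D' h
  ext v
  have := congrArg (fun a : ADivisor F => a (Sum.inr v)) h
  simpa using this

omit [NumberField F] in
/-- `ofFinDivisor (a[v]) = a·v`. [cite: Mochizuki2012, IUTchIV Def. 1.9 (i) p. 21] -/
theorem ofFinDivisor_of (v : HeightOneSpectrum (𝓞 F)) (a : ℝ) :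
    ofFinDivisor F (FinDivisor.of v a) = ADivisor.of (Sum.inr v) a := by
  simp [ofFinDivisor, FinDivisor.of, ADivisor.of, Finsupp.lmapDomain_apply, Finsupp.mapDomain_single]

omit [NumberField F] in
/-- Effectivity is preserved. [cite: Mochizuki2012, IUTchIV Def. 1.9 (i) p. 21] -/
theorem isEffective_ofFinDivisor {D : FinDivisor F} (hD : ∀ v, 0 ≤ D v) :
    (ofFinDivisor F D).IsEffective := by
  intro v
  rcases v with v | v
  · rw [ofFinDivisor_apply_inl]
  · rw [ofFinDivisor_apply_inr]; exact hD v

end ADivisor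

/-- **The degrees agree**: `deg_F(ofFinDivisor D) = deĝ_F(D)` (both weigh a finite place by
`log q_v = ln|κ(v)|`). [cite: Mochizuki2012, IUTchIV Def. 1.9 (i) p. 21] -/
theorem degF_ofFinDivisor (D : FinDivisor F) : degF F (ADivisor.ofFinDivisor F D) = FinDivisor.deg F D := by
  -- both sides are `ℝ`-linear in `D`; check on the basis `a[v]`
  suffices h : (degF F).comp (ADivisor.ofFinDivisor F) = FinDivisor.deg F from LinearMap.congr_fun h D
  apply Finsupp.lhom_ext'
  intro v
  apply LinearMap.ext_ring
  simp only [LinearMap.coe_comp, Function.comp_apply, Finsupp.lsingle_apply]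
  rw [show Finsupp.single v (1 : ℝ) = FinDivisor.of v 1 from rfl, ADivisor.ofFinDivisor_of, degF_of_inr,
    FinDivisor.deg_of]

/-- **The normalized degrees agree**: `deg(ofFinDivisor D) = deĝ̲_F(D)`.
[cite: Mochizuki2012, IUTchIV Def. 1.9 (i) p. 21] -/
theorem ndeg_ofFinDivisor (D : FinDivisor F) : ndeg F (ADivisor.ofFinDivisor F D) = FinDivisor.ndeg F D := by
  rw [ndeg_apply, FinDivisor.ndeg_apply, degF_ofFinDivisor]

end Literature.IUT.LogVolume
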